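import Literature.Analysis.Moments.MomentRecursionCarlson
import Literature.Analysis.FunctionSpaces.UniformRandomWalkMoments
import Literature.Combinatorics.Enumerative.DombNumbers
import HarnessLib

/-!
# The functional equations of the moment functions `W₃(s)` and `W₄(s)` of short uniform random walks

For the planar uniform random walks `S₃`, `S₄` (unit steps in uniformly random directions) let
`W_n(s) = E|S_n|^s` be the complex moments of the distance. Borwein, Straub, Wan and Zudilin
[BorweinEtAl2012, §2] display the functional equations

  `(s+4)² W₃(s+4) − 2(5s²+30s+46) W₃(s+2) + 9(s+2)² W₃(s) = 0`,
  `(s+4)³ W₄(s+4) − 4(s+3)(5s²+30s+48) W₄(s+2) + 64(s+2)³ W₄(s) = 0`   (Example 1),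

"coming from the inevitable recursion that exists for" the even moments `W_n(2k)`. This file
PROVES both for `Re s > 0`, as corollaries of the general lifting theorem
`Literature.Analysis.Moments.cmoment_functionalEquation` (Carlson's theorem) applied to the law of `|S_n|`
(carried by `[0, n]`) and the recursions of `W₃(2k) = Σ_i C(k,i)² C(2i,i)`
(`Literature.Combinatorics.Enumerative.threeStepMoment_recurrence`) and of the Domb numbers `W₄(2k)`
(`Literature.Combinatorics.Enumerative.domb_recurrence`):

* `Literature.Analysis.FunctionSpaces.momentFn n s = E|S_n|^s`
  (`= cmoment (normLaw n) s`, `normLaw n` the law of `|S_n|`), with `momentFn 3 (2k) = W₃(2k)`,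
  `momentFn 4 (2k) = D_k`;
* `W3_functionalEquation`, `W4_functionalEquation_of_re_pos`.

(The Mellin-transform treatment of `W₄` through the density `p₄`, valid on `Re s > −3/2`, is the
subject of `FourStepMomentFunctionalEquation.lean`.)

## References

* [BorweinEtAl2012] J. M. Borwein, A. Straub, J. Wan, W. Zudilin, *Densities of short uniform
  random walks*, Canad. J. Math. 64 (2012) 961–990 (arXiv:1103.2995), §2 (the displayed
  functional equation of `W₃`; Example 1 for `W₄`).
* J. M. Borwein, D. Nuyens, A. Straub, J. Wan, *Some arithmetic properties of short random walk
  integrals*, Ramanujan J. 26 (2011) 109–132.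
-/

noncomputable section

open MeasureTheory Set Real Complex Filter Polynomial Finset
open scoped Polynomial
open Literature.Analysis.Moments Literature.Combinatorics.Enumerative

namespace Literature.Analysis.FunctionSpaces

/-! ### The law of `|S_n|` and its complex moments -/

/-- The law of the distance `|S_n|` travelled in `n` steps (a probability measure on `ℝ`).
[cite: BorweinEtAl2012, §2] -/
def normLaw (n : ℕ) : Measure ℝ := (uniformWalkLaw n).map fun z : ℂ => ‖z‖

/-- The law of `|S_n|` is a probability measure. [folklore] -/
instance isProbabilityMeasure_normLaw (n : ℕ) : IsProbabilityMeasure (normLaw n) :=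
  Measure.isProbabilityMeasure_map continuous_norm.aemeasurable

/-- `|S_n| ∈ [0, n]` almost surely. [folklore] -/
theorem ae_mem_normLaw (n : ℕ) : ∀ᵐ x ∂(normLaw n), 0 ≤ x ∧ x ≤ (n : ℝ) := by
  have hmeas : MeasurableSet {x : ℝ | 0 ≤ x ∧ x ≤ (n : ℝ)} := measurableSet_Icc
  refine (ae_map_iff continuous_norm.aemeasurable hmeas).mpr ?_
  filter_upwards [ae_norm_le_uniformWalkLaw n] with z hz
  exact ⟨norm_nonneg z, hz⟩

/-- Even moments of `|S_n|`: `∫ x^{2k} d(law of |S_n|) = E|S_n|^{2k}`. [folklore] -/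
theorem integral_pow_normLaw (n k : ℕ) :
    ∫ x, x ^ (2 * k) ∂(normLaw n) = ∫ z, ‖z‖ ^ (2 * k) ∂(uniformWalkLaw n) :=
  integral_map continuous_norm.aemeasurable (continuous_id.pow _).aestronglyMeasurable

/-- `E|S₃|^{2k} = W₃(2k) = Σ_i C(k,i)² C(2i,i)`. [cite: BorweinEtAl2012, §1 eq. (1.1)] -/
theorem integral_pow_normLaw_three (k : ℕ) :
    ∫ x, x ^ (2 * k) ∂(normLaw 3) = (threeStepMoment k : ℝ) := by
  rw [integral_pow_normLaw, integral_norm_pow_three, threeStepMoment]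
  push_cast
  rfl

/-- `E|S₄|^{2k} = D_k` (Domb numbers). [cite: BorweinEtAl2012, §1 eq. (1.1)] -/
theorem integral_pow_normLaw_four (k : ℕ) :
    ∫ x, x ^ (2 * k) ∂(normLaw 4) = (domb k : ℝ) := by
  rw [integral_pow_normLaw, integral_norm_pow_four]
  simp only [domb, threeStepMoment]
  push_cast
  rfl

/-- **The complex moment function `W_n(s) = E|S_n|^s`** of the `n`-step walk.
[cite: BorweinEtAl2012, §2 (the moments W_n(s))] -/
def momentFn (n : ℕ) (s : ℂ) : ℂ := cmoment (normLaw n) s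

/-- `W₃(2k) = Σ_i C(k,i)² C(2i,i)`. [cite: BorweinEtAl2012, §1 eq. (1.1)] -/
theorem momentFn_three_two_mul_natCast (k : ℕ) : momentFn 3 (2 * k) = threeStepMoment k := by
  rw [momentFn, cmoment_two_mul_natCast, integral_pow_normLaw_three]
  push_cast
  rfl

/-- `W₄(2k) = D_k`. [cite: BorweinEtAl2012, §1 eq. (1.1)] -/
theorem momentFn_four_two_mul_natCast (k : ℕ) : momentFn 4 (2 * k) = domb k := by
  rw [momentFn, cmoment_two_mul_natCast, integral_pow_normLaw_four]
  push_cast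
  rfl

/-- `W_n` is holomorphic on `Re s > 0`. [cite: BorweinEtAl2012, §2] -/
theorem differentiableOn_momentFn (n : ℕ) : DifferentiableOn ℂ (momentFn n) {s : ℂ | 0 < s.re} :=
  differentiableOn_cmoment (ae_mem_normLaw n)

/-! ### `W₃` -/

/-- **The functional equation of `W₃`** [BorweinEtAl2012, §2]: for `Re s > 0`,
`(s+4)² W₃(s+4) − 2(5s²+30s+46) W₃(s+2) + 9(s+2)² W₃(s) = 0` — the recursion
`(k+2)²a_{k+2} − (10k²+30k+23)a_{k+1} + 9(k+1)²a_k = 0` of `a_k = W₃(2k)` lifted by Carlson's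
theorem. [cite: BorweinEtAl2012, §2 (functional equation of W₃)] -/
theorem W3_functionalEquation {s : ℂ} (hs : 0 < s.re) :
    (s + 4) ^ 2 * momentFn 3 (s + 4) - 2 * (5 * s ^ 2 + 30 * s + 46) * momentFn 3 (s + 2) +
      9 * (s + 2) ^ 2 * momentFn 3 s = 0 := by
  let P : ℕ → ℂ[X] := fun i =>
    if i = 0 then 9 * (2 * X + 2) ^ 2 else if i = 1 then -2 * (20 * X ^ 2 + 60 * X + 46)
      else (2 * X + 4) ^ 2
  have hP0 : ∀ u : ℂ, (P 0).eval u = 9 * (2 * u + 2) ^ 2 := fun u => by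
    simp [P, eval_pow]
  have hP1 : ∀ u : ℂ, (P 1).eval u = -2 * (20 * u ^ 2 + 60 * u + 46) := fun u => by
    simp [P, eval_pow]
  have hP2 : ∀ u : ℂ, (P 2).eval u = (2 * u + 4) ^ 2 := fun u => by
    simp [P, eval_pow]
  -- the recursion of the even moments
  have hrec : ∀ k : ℕ, ∑ i ∈ range (2 + 1),
      (P i).eval (k : ℂ) * ((∫ x, x ^ (2 * (k + i)) ∂(normLaw 3) : ℝ) : ℂ) = 0 := by
    intro k
    rw [Finset.sum_range_succ, Finset.sum_range_succ, Finset.sum_range_one, hP0, hP1, hP2]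
    simp only [integral_pow_normLaw_three, add_zero]
    have hR := threeStepMoment_recurrence (k := k + 1) (by omega)
    rw [Nat.add_sub_cancel, show k + 1 + 1 = k + 2 from rfl] at hR
    have hRC : ((k : ℂ) + 2) ^ 2 * (threeStepMoment (k + 2) : ℂ) +
        9 * ((k : ℂ) + 1) ^ 2 * (threeStepMoment k : ℂ) =
        (10 * ((k : ℂ) + 1) ^ 2 + 10 * ((k : ℂ) + 1) + 3) * (threeStepMoment (k + 1) : ℂ) := by
      exact_mod_cast hR
    push_cast
    linear_combination (4 : ℂ) * hRC
  have h := cmoment_functionalEquation (μ := normLaw 3) (M := (3 : ℕ)) (d := 2) (P := P)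
    (ae_mem_normLaw 3) hrec hs
  rw [Finset.sum_range_succ, Finset.sum_range_succ, Finset.sum_range_one, hP0, hP1, hP2] at h
  have a0 : s + 2 * ((0 : ℕ) : ℂ) = s := by push_cast; ring
  have a1 : s + 2 * ((1 : ℕ) : ℂ) = s + 2 := by push_cast; ring
  have a2 : s + 2 * ((2 : ℕ) : ℂ) = s + 4 := by push_cast; ring
  rw [a0, a1, a2] at h
  unfold momentFn
  linear_combination h

/-! ### `W₄` -/

/-- **The functional equation of `W₄`** [BorweinEtAl2012, §2 Example 1], on `Re s > 0`, from the
Domb recurrence by Carlson's theorem: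
`(s+4)³ W₄(s+4) − 4(s+3)(5s²+30s+48) W₄(s+2) + 64(s+2)³ W₄(s) = 0`.
[cite: BorweinEtAl2012, §2 Example 1 (functional equation of W₄)] -/
theorem W4_functionalEquation_of_re_pos {s : ℂ} (hs : 0 < s.re) :
    (s + 4) ^ 3 * momentFn 4 (s + 4) - 4 * (s + 3) * (5 * s ^ 2 + 30 * s + 48) * momentFn 4 (s + 2) +
      64 * (s + 2) ^ 3 * momentFn 4 s = 0 := by
  let P : ℕ → ℂ[X] := fun i =>
    if i = 0 then 64 * (2 * X + 2) ^ 3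
      else if i = 1 then -4 * (2 * X + 3) * (20 * X ^ 2 + 60 * X + 48) else (2 * X + 4) ^ 3
  have hP0 : ∀ u : ℂ, (P 0).eval u = 64 * (2 * u + 2) ^ 3 := fun u => by
    simp [P, eval_pow]
  have hP1 : ∀ u : ℂ, (P 1).eval u = -4 * (2 * u + 3) * (20 * u ^ 2 + 60 * u + 48) := fun u => by
    simp [P, eval_pow]
  have hP2 : ∀ u : ℂ, (P 2).eval u = (2 * u + 4) ^ 3 := fun u => by
    simp [P, eval_pow]
  have hrec : ∀ k : ℕ, ∑ i ∈ range (2 + 1),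
      (P i).eval (k : ℂ) * ((∫ x, x ^ (2 * (k + i)) ∂(normLaw 4) : ℝ) : ℂ) = 0 := by
    intro k
    rw [Finset.sum_range_succ, Finset.sum_range_succ, Finset.sum_range_one, hP0, hP1, hP2]
    simp only [integral_pow_normLaw_four, add_zero]
    have hR := domb_recurrence (k := k + 1) (by omega)
    rw [Nat.add_sub_cancel, show k + 1 + 1 = k + 2 from rfl] at hR
    have hRC : ((k : ℂ) + 2) ^ 3 * (domb (k + 2) : ℂ) + 64 * ((k : ℂ) + 1) ^ 3 * (domb k : ℂ) =
        2 * (2 * ((k : ℂ) + 1) + 1) * (5 * ((k : ℂ) + 1) ^ 2 + 5 * ((k : ℂ) + 1) + 2) *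
          (domb (k + 1) : ℂ) := by
      exact_mod_cast hR
    push_cast
    linear_combination (8 : ℂ) * hRC
  have h := cmoment_functionalEquation (μ := normLaw 4) (M := (4 : ℕ)) (d := 2) (P := P)
    (ae_mem_normLaw 4) hrec hs
  rw [Finset.sum_range_succ, Finset.sum_range_succ, Finset.sum_range_one, hP0, hP1, hP2] at h
  have a0 : s + 2 * ((0 : ℕ) : ℂ) = s := by push_cast; ring
  have a1 : s + 2 * ((1 : ℕ) : ℂ) = s + 2 := by push_cast; ring
  have a2 : s + 2 * ((2 : ℕ) : ℂ) = s + 4 := by push_cast; ring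
  rw [a0, a1, a2] at h
  unfold momentFn
  linear_combination h

/-- `W₄(0) = 1`, `W₄(2) = 4`, `W₄(4) = 28`. [cite: BorweinEtAl2012, §4] -/
theorem momentFn_four_values : momentFn 4 0 = 1 ∧ momentFn 4 2 = 4 ∧ momentFn 4 4 = 28 := by
  have h0 := momentFn_four_two_mul_natCast 0
  have h1 := momentFn_four_two_mul_natCast 1
  have h2 := momentFn_four_two_mul_natCast 2
  rw [domb_zero] at h0
  rw [domb_one] at h1
  rw [domb_two] at h2
  norm_num at h0 h1 h2
  exact ⟨h0, h1, h2⟩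

end Literature.Analysis.FunctionSpaces

end
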